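import Summits.Ventures.PercRepro.SixFourPLThird

/-!
# PercRepro — C-025 at `(6,4)`, §22.12.4: the planes of `M` are dominated by the plane list (p3, gen 10)

The three kinds of planes with a rank-`3` trace (`plane_trichotomy`) are matched to the three kinds of entries of
the plane list `𝒫(π)` of `SixFourPLList.lean` TYPE BY TYPE (`tyP_P₀`, `tyP_Pi`, `tyP_third`: `P₀ ↦ ρ`, `Π_y ↦ Π_j`
for its class, `{x} ∪ λ ↦ {x} ∪ λ`), the `Π_y` bijectively with the classes (`classes_eq_image`,
`injOn_inter_ρ_piPlanes`) and the third kind with multiplicity at most `n·ν_m` (`card_thirdPlanes_le`).  Hence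
**`sum_tyP_le`**: for every `F` that is nonnegative on the third-kind entries,
`Σ_{P ∈ planesR3} F(tyP P) ≤ Σ_{Q ∈ 𝒫(π)} mult(Q)·F(ty Q)` — the common form of steps (1) and (3) of 22.12.4.
-/

namespace PercRepro.SixFour

open Finset ThmH

variable {α : Type*} [DecidableEq α] {M : Matroid α} [M.Finite] {G : Finset α}

namespace PL

/-- Extensionality for `Pl`. -/
theorem Pl_ext {Q Q' : Pl} (hq : Q.q = Q'.q) (hl : Q.lines = Q'.lines) (hm : Q.mult = Q'.mult) : Q = Q' := by
  cases Q
  cases Q'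
  simp only at hq hl hm
  subst hq
  subst hl
  subst hm
  rfl

end PL

/-- `tyP P = ty Q` when the sizes and the line counts for `3 ≤ m ≤ 7` agree. -/
theorem tyP_eq_ty {P : Finset α} {Q : PL.Pl} (hq : (P ∩ G).card = Q.q)
    (hl : ∀ m, 3 ≤ m → m ≤ 7 → inc M (P ∩ G) m = PL.Lcount Q m) : tyP M G P = PL.ty Q := by
  apply PL.Pl_ext
  · exact hq
  · unfold tyP PL.ty
    dsimp only
    refine List.map_congr_left (fun i hi => ?_)
    rw [List.mem_range] at hi
    rw [hl (i + 3) (by omega) (by omega)]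
  · rfl

/-- A list sum over `range n` is a finset sum (additive monoid version). -/
theorem list_sum_range' {β : Type*} [AddCommMonoid β] (f : ℕ → β) :
    ∀ n : ℕ, ((List.range n).map f).sum = ∑ i ∈ Finset.range n, f i
  | 0 => by simp
  | n + 1 => by
    rw [List.range_succ, List.map_append, List.sum_append, Finset.sum_range_succ, list_sum_range' f n]
    simp

omit [DecidableEq α] [M.Finite] in
/-- A set of rank `2` has at least two points. -/
theorem card_ge_two_of_rank_two {X : Finset α} (hr : M.eRk (X : Set α) = 2) : 2 ≤ X.card := by
  have := M.eRk_le_encard (X : Set α)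
  rw [hr, Set.encard_coe_eq_coe_finsetCard] at this
  exact_mod_cast this

namespace PLData

variable {D : PLData M G}

/-- `g(π) = |G|`. -/
theorem g_profile : PL.g D.profile = G.card := D.card_ρ_add_card_L

/-! ## The types of the three kinds of planes -/

/-- `tyP P₀ = ty (rhoEntry π)`. -/
theorem tyP_P₀ : tyP M G D.P₀ = PL.ty (PL.rhoEntry D.profile) := by
  apply tyP_eq_ty
  · rfl
  · intro m h3 h7
    rw [PL.Lcount_rhoEntry _ m (by omega) h7, incOf_profile (by omega) h7]
    rfl

/-- `tyP Π_y = ty (piEntry π |λ_y|)`. -/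
theorem tyP_Pi (hs : Simple M) (hG : G ⊆ gr M) (h2 : 2 ≤ D.L.card) {y : α} (hy : y ∈ D.ρ \ D.ellF) :
    tyP M G (D.Pi y) = PL.ty (PL.piEntry D.profile (D.lam y).card) := by
  apply tyP_eq_ty
  · rw [PL.piEntry_q, card_Pi_trace hs hG h2 y]
    rfl
  · intro m h3 _
    rw [PL.Lcount_piEntry _ _ m h3, inc_Pi hs hG h2 hy h3, card_ellF_inter_G_eq hs hG h2]

/-- `tyP P = ty (xlEntry π (|P ∩ ρ| − 2))` for a plane of the third kind. -/
theorem tyP_third (hs : Simple M) (hG : G ⊆ gr M) (h2 : 2 ≤ D.L.card) {P : Finset α} {x : α} (hx : x ∈ D.L)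
    (htr : P ∩ G = insert x (P ∩ D.ρ)) (hr2 : M.eRk ((P ∩ D.ρ : Finset α) : Set α) = 2) :
    tyP M G P = PL.ty (PL.xlEntry D.profile ((P ∩ D.ρ).card - 2)) := by
  have hc2 := card_ge_two_of_rank_two hr2
  apply tyP_eq_ty
  · rw [PL.xlEntry_q, htr, Finset.card_insert_of_notMem]
    · omega
    · intro h
      exact notMem_ρ_of_mem_L hx (Finset.mem_inter.1 h).2
  · intro m h3 _
    rw [PL.Lcount_xlEntry _ _ m h3, inc_third hs hG h2 hx htr hr2 h3,
      show (P ∩ D.ρ).card - 2 + 2 = (P ∩ D.ρ).card by omega]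

/-! ## The sum over `planesR3`, in three parts -/

/-- The three-way split of a sum over `planesR3`: `P₀`, the `Π_y`, the rest. -/
theorem sum_planesR3_eq (hs : Simple M) (hG : G ⊆ gr M) (h2 : 2 ≤ D.L.card) (f : Finset α → ℚ) :
    ∑ P ∈ planesR3 M G, f P = f D.P₀ + ∑ P ∈ D.piPlanes, f P +
      ∑ P ∈ (planesR3 M G).filter (fun P => P ≠ D.P₀ ∧ P ∉ D.piPlanes), f P := by
  rw [← Finset.sum_filter_add_sum_filter_not (planesR3 M G) (fun P => P = D.P₀ ∨ P ∈ D.piPlanes)]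
  have h1 : (planesR3 M G).filter (fun P => P = D.P₀ ∨ P ∈ D.piPlanes) = insert D.P₀ D.piPlanes := by
    ext P
    rw [Finset.mem_filter, Finset.mem_insert]
    constructor
    · rintro ⟨-, h⟩
      exact h
    · rintro (rfl | h)
      · exact ⟨P₀_mem_planesR3, Or.inl rfl⟩
      · exact ⟨piPlanes_subset hs hG h2 h, Or.inr h⟩
  have h2' : (planesR3 M G).filter (fun P => ¬ (P = D.P₀ ∨ P ∈ D.piPlanes)) =
      (planesR3 M G).filter (fun P => P ≠ D.P₀ ∧ P ∉ D.piPlanes) :=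
    Finset.filter_congr (fun P _ => not_or)
  rw [h1, h2', Finset.sum_insert (P₀_notMem_piPlanes hs hG h2)]

/-- `(· ∩ ρ)` is injective on the `Π_y` planes. -/
theorem injOn_inter_ρ_piPlanes (hs : Simple M) (hG : G ⊆ gr M) (h2 : 2 ≤ D.L.card) :
    Set.InjOn (fun P : Finset α => P ∩ D.ρ) D.piPlanes := by
  intro P hP P' hP' heq
  rw [Finset.mem_coe] at hP hP'
  obtain ⟨y, hy, rfl⟩ := mem_piPlanes.1 hP
  obtain ⟨y', hy', rfl⟩ := mem_piPlanes.1 hP'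
  simp only at heq
  rw [Finset.mem_sdiff] at hy hy'
  have hy'Pi : y' ∈ D.Pi y := by
    have : y' ∈ D.lam y := by
      show y' ∈ D.Pi y ∩ D.ρ
      rw [heq]
      exact mem_lam_self hs hG h2 hy'.1 hy'.2
    exact (Finset.mem_inter.1 this).1
  exact (Pi_eq_of_mem hs hG h2 (D.ρ_subset hy.1) hy.2 (D.ρ_subset hy'.1) hy'.2 hy'Pi).symm

/-- `classes = piPlanes.image (· ∩ ρ)`. -/
theorem classes_eq_image : D.classes = D.piPlanes.image (fun P => P ∩ D.ρ) := by
  unfold classes piPlanes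
  rw [Finset.image_image]
  rfl

/-- The sizes as a multiset are the class cards. -/
theorem sizes_coe : (D.sizes : Multiset ℕ) = D.classes.val.map Finset.card := by
  simp only [sizes, Multiset.coe_reverse, Multiset.sort_eq]

/-- The sum over the `Π_y` planes of a function of the type is the list sum over the class sizes. -/
theorem sum_piPlanes_eq (hs : Simple M) (hG : G ⊆ gr M) (h2 : 2 ≤ D.L.card) (F : PL.Pl → ℚ) :
    ∑ P ∈ D.piPlanes, F (tyP M G P) = (D.sizes.map fun s => F (PL.ty (PL.piEntry D.profile s))).sum := by
  have h1 : ∑ P ∈ D.piPlanes, F (tyP M G P) =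
      ∑ P ∈ D.piPlanes, F (PL.ty (PL.piEntry D.profile (P ∩ D.ρ).card)) := by
    refine Finset.sum_congr rfl (fun P hP => ?_)
    obtain ⟨y, hy, rfl⟩ := mem_piPlanes.1 hP
    rw [tyP_Pi hs hG h2 hy]
    rfl
  have h3 := Finset.sum_image (f := fun C : Finset α => F (PL.ty (PL.piEntry D.profile C.card)))
    (injOn_inter_ρ_piPlanes hs hG h2)
  rw [h1, ← h3, ← classes_eq_image, Finset.sum_eq_multiset_sum, ← Multiset.sum_coe, ← Multiset.map_coe, sizes_coe,
    Multiset.map_map]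
  rfl

/-- The third-kind sum is at most `Σ_i n·ν_{i+2}·F(xlEntry i)` for `F ≥ 0` on those entries. -/
theorem sum_third_le (hs : Simple M) (hG : G ⊆ gr M) (hpl : ∀ P ∈ planes M, (P ∩ G).card ≤ 7) (hg : 10 ≤ G.card)
    (F : PL.Pl → ℚ) (hF : ∀ i < 6, 0 ≤ F (PL.ty (PL.xlEntry D.profile i))) :
    ∑ P ∈ (planesR3 M G).filter (fun P => P ≠ D.P₀ ∧ P ∉ D.piPlanes), F (tyP M G P) ≤
      ∑ i ∈ Finset.range 6, ((D.L.card * PL.nu D.profile (i + 2) : ℕ) : ℚ) * F (PL.ty (PL.xlEntry D.profile i)) := by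
  have h2 : 2 ≤ D.L.card := by have := D.three_le_card_L (hpl _ D.plane) hg; omega
  set T := (planesR3 M G).filter (fun P => P ≠ D.P₀ ∧ P ∉ D.piPlanes) with hT
  have hbounds : ∀ P ∈ T, 2 ≤ (P ∩ D.ρ).card ∧ (P ∩ D.ρ).card ≤ 7 := by
    intro P hP
    rw [hT, Finset.mem_filter] at hP
    obtain ⟨hP3, hne, hnPi⟩ := hP
    obtain ⟨x, hx, htr, hr2, -⟩ := third_spec hs hG h2 hP3 hne hnPi
    refine ⟨card_ge_two_of_rank_two hr2, ?_⟩
    exact (Finset.card_le_card (Finset.inter_subset_inter (Finset.Subset.refl P) D.ρ_subset)).trans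
      (hpl P (mem_planesR3.1 hP3).1)
  rw [← Finset.sum_fiberwise_of_maps_to (g := fun P : Finset α => (P ∩ D.ρ).card - 2) (t := Finset.range 6)
    (fun P hP => by rw [Finset.mem_range]; have := hbounds P hP; omega)]
  refine Finset.sum_le_sum (fun i hi => ?_)
  rw [Finset.mem_range] at hi
  have hconst : ∀ P ∈ T.filter (fun P => (P ∩ D.ρ).card - 2 = i),
      F (tyP M G P) = F (PL.ty (PL.xlEntry D.profile i)) := by
    intro P hP
    simp only [Finset.mem_filter, hT] at hP
    obtain ⟨⟨hP3, hne, hnPi⟩, hi'⟩ := hP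
    obtain ⟨x, hx, htr, hr2, -⟩ := third_spec hs hG h2 hP3 hne hnPi
    rw [tyP_third hs hG h2 hx htr hr2, hi']
  have hsub : T.filter (fun P => (P ∩ D.ρ).card - 2 = i) ⊆ D.thirdPlanes (i + 2) := by
    intro P hP
    simp only [Finset.mem_filter, hT] at hP
    obtain ⟨⟨hP3, hne, hnPi⟩, hi'⟩ := hP
    obtain ⟨x, hx, htr, hr2, -⟩ := third_spec hs hG h2 hP3 hne hnPi
    have h2c := card_ge_two_of_rank_two hr2
    exact Finset.mem_filter.2 ⟨hP3, hne, hnPi, by omega⟩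
  rw [Finset.sum_congr rfl hconst, Finset.sum_const, nsmul_eq_mul]
  have hcard : (T.filter (fun P => (P ∩ D.ρ).card - 2 = i)).card ≤ D.L.card * PL.nu D.profile (i + 2) :=
    (Finset.card_le_card hsub).trans (card_thirdPlanes_le hs hG hpl hg (by omega) (by omega))
  exact mul_le_mul_of_nonneg_right (by exact_mod_cast hcard) (hF i hi)

/-- **The list dominates the planes (22.12.4)**: for every `F : Pl → ℚ` nonnegative on the third-kind entries,
`Σ_{P ∈ planesR3} F(tyP P) ≤ Σ_{Q ∈ 𝒫(π)} mult(Q)·F(ty Q)`. -/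
theorem sum_tyP_le (hs : Simple M) (hG : G ⊆ gr M) (hpl : ∀ P ∈ planes M, (P ∩ G).card ≤ 7) (hg : 10 ≤ G.card)
    (F : PL.Pl → ℚ) (hF : ∀ i < 6, 0 ≤ F (PL.ty (PL.xlEntry D.profile i))) :
    ∑ P ∈ planesR3 M G, F (tyP M G P) ≤
      ((PL.planes D.profile).map fun Q => (Q.mult : ℚ) * F (PL.ty Q)).sum := by
  have h2 : 2 ≤ D.L.card := by have := D.three_le_card_L (hpl _ D.plane) hg; omega
  rw [PL.planes_eq, List.map_append, List.map_append, List.sum_append, List.sum_append, List.map_map,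
    List.map_map, List.map_cons, List.map_nil, List.sum_cons, List.sum_nil, add_zero,
    show D.profile.sizes = D.sizes from rfl, sum_planesR3_eq hs hG h2, tyP_P₀, sum_piPlanes_eq hs hG h2 F]
  have hmult : (D.sizes.map ((fun Q : PL.Pl => (Q.mult : ℚ) * F (PL.ty Q)) ∘ PL.piEntry D.profile)).sum =
      (D.sizes.map fun s => F (PL.ty (PL.piEntry D.profile s))).sum := by
    refine congrArg List.sum (List.map_congr_left (fun s _ => ?_))
    simp only [Function.comp_apply, PL.piEntry_mult, Nat.cast_one, one_mul]
  have hxl : ((List.range 6).map ((fun Q : PL.Pl => (Q.mult : ℚ) * F (PL.ty Q)) ∘ PL.xlEntry D.profile)).sum =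
      ∑ i ∈ Finset.range 6, ((D.L.card * PL.nu D.profile (i + 2) : ℕ) : ℚ) * F (PL.ty (PL.xlEntry D.profile i)) := by
    rw [list_sum_range']
    refine Finset.sum_congr rfl (fun i _ => ?_)
    simp only [Function.comp_apply, PL.xlEntry_mult]
    rfl
  rw [hmult, hxl, PL.rhoEntry_mult, Nat.cast_one, one_mul]
  have := sum_third_le hs hG hpl hg F hF
  linarith

end PLData

end PercRepro.SixFour
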